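import Mathlib
import Literature.Analysis.FluidPDE.CoordDerivatives
import Literature.Analysis.FluidPDE.NSVorticityEnergy
import Literature.Analysis.FluidPDE.KNSSThm52Integrand
import Literature.Analysis.FluidPDE.NSVorticityBKMProofs
import Literature.Analysis.FluidPDE.AxisymNoSwirlVorticity
import Summits.NavierStokesRegularity.NavierStokesRegularity.Theorems.SelfMixingDichotomyCoherentScaleExclusionPassiveScalarL1AntitoneTools
import HarnessLib

/-!
# `SlicedKelvin.FoldLawEps` — tools II: decay atoms and pointwise identities (item
  stmt-NavierStokesRegularity-15606, part 2 of 3)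

For a smooth rapidly decaying field `u` on `ℝ³` with `ω = curl u`:

* cubic decay `≤ C (1 + ‖x‖)⁻³` of the components of `u`, `∇u`, `ω`, `∇ω`, `∇²ω`
  (`FoldLaw.decay_*`; `HasRapidSpatialDecay` gives every `(1+‖x‖)³ ‖Dⁿu(x)‖ ≤ Cₙ`, and
  `‖Dⁿ(curl u)‖ ≤ ‖curlCLM‖ ‖Dⁿ⁺¹u‖`);
* the calculus of the regularised modulus `F_ε(s) = √(s² + ε²)` (elementary bounds reused from
  `PassiveScalarL1`): `F' = s/F`, `F'' = ε²/F³`, `0 ≤ F'' ≤ 1/ε`, and the chain rules for `F_ε ∘ f`, `F_ε' ∘ f`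
  along the coordinate partial derivatives (`FoldLaw.pderiv_F_comp`, `…`);
* the coordinate forms of `(Δω)₂` and `(curl (ω × u))₂`.

HONEST FRAMING: multivariable calculus; nothing here bears on the regularity problem itself.
-/

noncomputable section

set_option linter.dupNamespace false

namespace Summit.NavierStokesRegularity.NavierStokesRegularity.Theorems

open MeasureTheory Set Filter Topology Metric Function Literature.Analysis.FluidPDE
open scoped NNReal ENNReal ContDiff Laplacian

namespace FoldLaw

variable {u : EuclideanSpace ℝ (Fin 3) → EuclideanSpace ℝ (Fin 3)}

/-! ### Decay atoms -/

/-- `‖Dⁿ u (x)‖ ≤ C (1 + ‖x‖)⁻³` from rapid decay. [folklore] -/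
theorem decay_iteratedFDeriv (hdec : HasRapidSpatialDecay u) (n : ℕ) :
    ∃ C : ℝ, ∀ x, ‖iteratedFDeriv ℝ n u x‖ ≤ C / (1 + ‖x‖) ^ 3 := by
  obtain ⟨C, hC⟩ := hdec n 3
  refine ⟨C, fun x => ?_⟩
  rw [le_div_iff₀ (by positivity), mul_comm]
  exact hC x

/-- `‖Dⁿ (curl u) (x)‖ ≤ C (1 + ‖x‖)⁻³` from rapid decay. [folklore] -/
theorem decay_iteratedFDeriv_curl (hu : ContDiff ℝ ∞ u) (hdec : HasRapidSpatialDecay u) (n : ℕ) :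
    ∃ C : ℝ, ∀ x, ‖iteratedFDeriv ℝ n (curl u) x‖ ≤ C / (1 + ‖x‖) ^ 3 := by
  obtain ⟨C, hC⟩ := decay_iteratedFDeriv hdec (n + 1)
  refine ⟨‖(curlCLM : ((EuclideanSpace ℝ (Fin 3)) →L[ℝ] (EuclideanSpace ℝ (Fin 3))) →L[ℝ]
      (EuclideanSpace ℝ (Fin 3)))‖ * C, fun x => ?_⟩
  refine (norm_iteratedFDeriv_curl_le (hu.of_le (by exact_mod_cast le_top)) x).trans ?_
  rw [mul_div_assoc]
  exact mul_le_mul_of_nonneg_left (hC x) (norm_nonneg (curlCLM :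
    ((EuclideanSpace ℝ (Fin 3)) →L[ℝ] (EuclideanSpace ℝ (Fin 3))) →L[ℝ] (EuclideanSpace ℝ (Fin 3))))

/-- Components of a field with decaying `Dᵐ` have decaying word derivatives of length `m`:
`|∂^α vⱼ (x)| ≤ ‖Dᵐ v (x)‖`. [folklore] -/
theorem abs_ipderiv_apply_le {v : EuclideanSpace ℝ (Fin 3) → EuclideanSpace ℝ (Fin 3)}
    (hv : ContDiff ℝ ∞ v) {m : ℕ} (α : Fin m → Fin 3) (j : Fin 3) (x : EuclideanSpace ℝ (Fin 3)) :
    |ipderiv α (fun y => v y j) x| ≤ ‖iteratedFDeriv ℝ m v x‖ :=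
  (abs_ipderiv_le_norm_iteratedFDeriv (contDiff_euclidean.1 hv j) α x).trans
    (norm_iteratedFDeriv_apply_le hv j m x)

/-- Decay of the components `vⱼ`. [folklore] -/
theorem decay_apply {v : EuclideanSpace ℝ (Fin 3) → EuclideanSpace ℝ (Fin 3)} (hv : ContDiff ℝ ∞ v)
    {C : ℝ} (hC : ∀ x, ‖iteratedFDeriv ℝ 0 v x‖ ≤ C / (1 + ‖x‖) ^ 3) (j : Fin 3) :
    ∀ x, |v x j| ≤ C / (1 + ‖x‖) ^ 3 := fun x =>
  (abs_ipderiv_apply_le hv (m := 0) ![] j x).trans (hC x)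

/-- Decay of the first partials `∂ᵢvⱼ`. [folklore] -/
theorem decay_pderiv_apply {v : EuclideanSpace ℝ (Fin 3) → EuclideanSpace ℝ (Fin 3)}
    (hv : ContDiff ℝ ∞ v) {C : ℝ} (hC : ∀ x, ‖iteratedFDeriv ℝ 1 v x‖ ≤ C / (1 + ‖x‖) ^ 3)
    (i j : Fin 3) : ∀ x, |pderiv i (fun y => v y j) x| ≤ C / (1 + ‖x‖) ^ 3 := fun x => by
  have h := abs_ipderiv_apply_le hv ![i] j x
  rw [show (![i] : Fin 1 → Fin 3) = Fin.cons i ![] from rfl, ipderiv_cons, ipderiv_zero] at h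
  exact h.trans (hC x)

/-- Decay of the pure second partials `∂ᵢ∂ᵢvⱼ`. [folklore] -/
theorem decay_pderiv_pderiv_apply {v : EuclideanSpace ℝ (Fin 3) → EuclideanSpace ℝ (Fin 3)}
    (hv : ContDiff ℝ ∞ v) {C : ℝ} (hC : ∀ x, ‖iteratedFDeriv ℝ 2 v x‖ ≤ C / (1 + ‖x‖) ^ 3)
    (i j : Fin 3) : ∀ x, |pderiv i (pderiv i (fun y => v y j)) x| ≤ C / (1 + ‖x‖) ^ 3 := fun x => by
  have h := abs_ipderiv_apply_le hv ![i, i] j x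
  rw [show (![i, i] : Fin 2 → Fin 3) = Fin.cons i (Fin.cons i ![]) from rfl, ipderiv_cons,
    ipderiv_cons, ipderiv_zero] at h
  exact h.trans (hC x)

/-! ### The regularised modulus `F_ε(s) = √(s² + ε²)` -/

section Modulus

variable {ε : ℝ}

/-- `0 ≤ F_ε''(s) = ε² / F_ε(s)³ ≤ 1/ε`. [folklore] -/
theorem abs_Fsecond_le (hε : 0 < ε) (s : ℝ) : |ε ^ 2 / Real.sqrt (s ^ 2 + ε ^ 2) ^ 3| ≤ 1 / ε := by
  have hF := PassiveScalarL1.sqrt_sq_add_sq_pos hε s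
  have hFε := PassiveScalarL1.le_sqrt_sq_add_sq hε.le s
  rw [abs_of_nonneg (by positivity), div_le_div_iff₀ (by positivity) hε]
  calc ε ^ 2 * ε = ε ^ 3 := by ring
    _ ≤ Real.sqrt (s ^ 2 + ε ^ 2) ^ 3 := pow_le_pow_left₀ hε.le hFε 3
    _ = 1 * Real.sqrt (s ^ 2 + ε ^ 2) ^ 3 := (one_mul _).symm

/-- `F_ε' = s / F_ε`. [folklore] -/
theorem hasDerivAt_F (hε : 0 < ε) (s : ℝ) :
    HasDerivAt (fun s => Real.sqrt (s ^ 2 + ε ^ 2)) (s / Real.sqrt (s ^ 2 + ε ^ 2)) s := by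
  have h1 : HasDerivAt (fun s => s ^ 2 + ε ^ 2) (2 * s) s := by
    simpa using ((hasDerivAt_pow 2 s).add_const (ε ^ 2))
  have h2 := h1.sqrt (by positivity : s ^ 2 + ε ^ 2 ≠ 0)
  have e : 2 * s / (2 * Real.sqrt (s ^ 2 + ε ^ 2)) = s / Real.sqrt (s ^ 2 + ε ^ 2) :=
    mul_div_mul_left s _ two_ne_zero
  rw [e] at h2
  exact h2

/-- `F_ε'' = ε² / F_ε³`. [folklore] -/
theorem hasDerivAt_Fprime (hε : 0 < ε) (s : ℝ) :
    HasDerivAt (fun s => s / Real.sqrt (s ^ 2 + ε ^ 2)) (ε ^ 2 / Real.sqrt (s ^ 2 + ε ^ 2) ^ 3) s := by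
  have hF := PassiveScalarL1.sqrt_sq_add_sq_pos hε s
  have h := (hasDerivAt_id s).div (hasDerivAt_F hε s) hF.ne'
  refine h.congr_deriv ?_
  have hsq : Real.sqrt (s ^ 2 + ε ^ 2) ^ 2 = s ^ 2 + ε ^ 2 := Real.sq_sqrt (by positivity)
  simp only [id]
  rw [div_eq_div_iff (by positivity) (by positivity)]
  have e1 : (1 * Real.sqrt (s ^ 2 + ε ^ 2) - s * (s / Real.sqrt (s ^ 2 + ε ^ 2))) =
      ε ^ 2 / Real.sqrt (s ^ 2 + ε ^ 2) := by
    field_simp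
    nlinarith [hsq]
  rw [e1]
  field_simp

/-- `F_ε` and `F_ε'` are continuous. [folklore] -/
theorem continuous_F (ε : ℝ) : Continuous fun s : ℝ => Real.sqrt (s ^ 2 + ε ^ 2) := by fun_prop

/-- `F_ε'' = ε²/F_ε³` is continuous. [folklore] -/
theorem continuous_Fsecond (hε : 0 < ε) :
    Continuous fun s : ℝ => ε ^ 2 / Real.sqrt (s ^ 2 + ε ^ 2) ^ 3 :=
  continuous_const.div ((continuous_F ε).pow 3) fun s => by positivity [PassiveScalarL1.sqrt_sq_add_sq_pos hε s]

/-- **Chain rule** `∂ᵢ (φ ∘ g) = φ'(g) ∂ᵢ g` for a scalar `φ`. [folklore] -/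
theorem pderiv_scalar_comp {φ : ℝ → ℝ} {g : EuclideanSpace ℝ (Fin 3) → ℝ} {d : ℝ}
    {x : EuclideanSpace ℝ (Fin 3)} (hφ : HasDerivAt φ d (g x)) (hg : DifferentiableAt ℝ g x)
    (i : Fin 3) : pderiv i (fun y => φ (g y)) x = d * pderiv i g x := by
  have hc : HasFDerivAt (fun y => φ (g y)) (d • fderiv ℝ g x) x := hφ.comp_hasFDerivAt x hg.hasFDerivAt
  rw [pderiv_apply, pderiv_apply, hc.fderiv]
  simp [smul_eq_mul]

end Modulus

/-! ### Coordinate forms of `(Δω)₂` and `(curl (ω × u))₂` -/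

/-- `curl u` is smooth for smooth `u`. [folklore] -/
theorem contDiff_curl_top (hu : ContDiff ℝ ∞ u) : ContDiff ℝ ∞ (curl u) := by
  rw [curl_eq_curlCLM_comp]
  exact curlCLM.contDiff.comp (hu.fderiv_right (m := ∞) (by exact_mod_cast le_top))

/-- `(Δω)₂ = ∑ⱼ ∂ⱼ∂ⱼ ω₂`. [folklore] -/
theorem laplacian_curl_apply_two (hu : ContDiff ℝ ∞ u) (x : EuclideanSpace ℝ (Fin 3)) :
    (Δ (curl u)) x 2 =
      pderiv 0 (pderiv 0 fun y => curl u y 2) x + pderiv 1 (pderiv 1 fun y => curl u y 2) x +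
        pderiv 2 (pderiv 2 fun y => curl u y 2) x := by
  rw [laplacian_apply_comp ((contDiff_curl_top hu).of_le (by norm_cast)) x 2,
    Fin.sum_univ_three]

/-- `z ↦ ω(z) × u(z)` is smooth. [folklore] -/
theorem contDiff_cross_curl (hu : ContDiff ℝ ∞ u) :
    ContDiff ℝ ∞ fun z => cross (curl u z) (u z) := by
  have h1 : ContDiff ℝ ∞ fun z => crossCLM (curl u z) := crossCLM.contDiff.comp (contDiff_curl_top hu)
  exact h1.clm_apply hu

/-- `(curl (ω × u))₂ = ∂₀(ω₂u₀ − ω₀u₂) − ∂₁(ω₁u₂ − ω₂u₁)`. [folklore] -/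
theorem curl_cross_apply_two (hu : ContDiff ℝ ∞ u) (x : EuclideanSpace ℝ (Fin 3)) :
    curl (fun z => cross (curl u z) (u z)) x 2 =
      pderiv 0 (fun z => curl u z 2 * u z 0 - curl u z 0 * u z 2) x -
        pderiv 1 (fun z => curl u z 1 * u z 2 - curl u z 2 * u z 1) x := by
  have hd : DifferentiableAt ℝ (fun z => cross (curl u z) (u z)) x :=
    ((contDiff_cross_curl hu).differentiable (by simp)) x
  rw [curl_apply_two, euclidean_fderiv_apply_comp hd, euclidean_fderiv_apply_comp hd]
  have e1 : (fun z => cross (curl u z) (u z) 1) = fun z => curl u z 2 * u z 0 - curl u z 0 * u z 2 := by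
    funext z; simp [cross, cross_apply]
  have e0 : (fun z => cross (curl u z) (u z) 0) = fun z => curl u z 1 * u z 2 - curl u z 2 * u z 1 := by
    funext z; simp [cross, cross_apply]
  rw [e1, e0]
  rfl

/-- **Incompressibility in coordinates**: `∂₀u₀ + ∂₁u₁ + ∂₂u₂ = 0`. [folklore] -/
theorem sum_pderiv_eq_zero (hu : ContDiff ℝ ∞ u) (hdiv : VectorCalculus.IsDivFree u)
    (x : EuclideanSpace ℝ (Fin 3)) :
    pderiv 0 (fun y => u y 0) x + pderiv 1 (fun y => u y 1) x + pderiv 2 (fun y => u y 2) x = 0 := by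
  have h := hdiv.sum_pderiv_comp_eq_zero (hu.differentiable (by simp)) x
  rwa [Fin.sum_univ_three] at h

/-- `F_ε` is smooth (`s² + ε² > 0`). [folklore] -/
theorem contDiff_F {ε : ℝ} (hε : 0 < ε) : ContDiff ℝ ∞ fun s : ℝ => Real.sqrt (s ^ 2 + ε ^ 2) :=
  ((contDiff_id.pow 2).add contDiff_const).sqrt fun s => by positivity

/-- `F_ε' = s / F_ε` is smooth. [folklore] -/
theorem contDiff_Fprime {ε : ℝ} (hε : 0 < ε) :
    ContDiff ℝ ∞ fun s : ℝ => s / Real.sqrt (s ^ 2 + ε ^ 2) :=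
  contDiff_id.div (contDiff_F hε) fun s => (PassiveScalarL1.sqrt_sq_add_sq_pos hε s).ne'

/-! ### Packaged atoms -/

/-- **Decay atoms**: one constant `K` bounding `(1 + ‖x‖)³` times the components of `u`, `∇u`,
`ω = curl u`, `∇ω` and the pure second partials `∂ᵢ∂ᵢω` of a smooth rapidly decaying field.
[folklore] -/
theorem decay_atoms (hu : ContDiff ℝ ∞ u) (hdec : HasRapidSpatialDecay u) :
    ∃ K : ℝ, (∀ j x, |u x j| ≤ K / (1 + ‖x‖) ^ 3) ∧
      (∀ i j x, |pderiv i (fun y => u y j) x| ≤ K / (1 + ‖x‖) ^ 3) ∧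
      (∀ j x, |curl u x j| ≤ K / (1 + ‖x‖) ^ 3) ∧
      (∀ i j x, |pderiv i (fun y => curl u y j) x| ≤ K / (1 + ‖x‖) ^ 3) ∧
      (∀ i j x, |pderiv i (pderiv i (fun y => curl u y j)) x| ≤ K / (1 + ‖x‖) ^ 3) := by
  have hω := contDiff_curl_top hu
  obtain ⟨A₀, hA₀⟩ := decay_iteratedFDeriv hdec 0
  obtain ⟨A₁, hA₁⟩ := decay_iteratedFDeriv hdec 1
  obtain ⟨B₀, hB₀⟩ := decay_iteratedFDeriv_curl hu hdec 0
  obtain ⟨B₁, hB₁⟩ := decay_iteratedFDeriv_curl hu hdec 1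
  obtain ⟨B₂, hB₂⟩ := decay_iteratedFDeriv_curl hu hdec 2
  set K : ℝ := |A₀| + |A₁| + |B₀| + |B₁| + |B₂| with hK
  have hle : ∀ {C : ℝ} (x : EuclideanSpace ℝ (Fin 3)), C ≤ K → C / (1 + ‖x‖) ^ 3 ≤ K / (1 + ‖x‖) ^ 3 :=
    fun x h => div_le_div_of_nonneg_right h (by positivity)
  have h0 : A₀ ≤ K := by rw [hK]; linarith [le_abs_self A₀, abs_nonneg A₁, abs_nonneg B₀, abs_nonneg B₁, abs_nonneg B₂]
  have h1 : A₁ ≤ K := by rw [hK]; linarith [le_abs_self A₁, abs_nonneg A₀, abs_nonneg B₀, abs_nonneg B₁, abs_nonneg B₂]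
  have h2 : B₀ ≤ K := by rw [hK]; linarith [le_abs_self B₀, abs_nonneg A₀, abs_nonneg A₁, abs_nonneg B₁, abs_nonneg B₂]
  have h3 : B₁ ≤ K := by rw [hK]; linarith [le_abs_self B₁, abs_nonneg A₀, abs_nonneg A₁, abs_nonneg B₀, abs_nonneg B₂]
  have h4 : B₂ ≤ K := by rw [hK]; linarith [le_abs_self B₂, abs_nonneg A₀, abs_nonneg A₁, abs_nonneg B₀, abs_nonneg B₁]
  exact ⟨K, fun j x => (decay_apply hu hA₀ j x).trans (hle x h0),
    fun i j x => (decay_pderiv_apply hu hA₁ i j x).trans (hle x h1),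
    fun j x => (decay_apply hω hB₀ j x).trans (hle x h2),
    fun i j x => (decay_pderiv_apply hω hB₁ i j x).trans (hle x h3),
    fun i j x => (decay_pderiv_pderiv_apply hω hB₂ i j x).trans (hle x h4)⟩

/-- **Smoothness atoms**: the components of `u`, `ω` and their partials are smooth. [folklore] -/
theorem smooth_atoms (hu : ContDiff ℝ ∞ u) :
    (∀ j, ContDiff ℝ ∞ fun y => u y j) ∧ (∀ j, ContDiff ℝ ∞ fun y => curl u y j) ∧
      (∀ i j, ContDiff ℝ ∞ (pderiv i fun y => u y j)) ∧
      (∀ i j, ContDiff ℝ ∞ (pderiv i fun y => curl u y j)) ∧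
      (∀ i j, ContDiff ℝ ∞ (pderiv i (pderiv i fun y => curl u y j))) := by
  have hω := contDiff_curl_top hu
  have h1 : ∀ j, ContDiff ℝ ∞ fun y => u y j := fun j => contDiff_euclidean.1 hu j
  have h2 : ∀ j, ContDiff ℝ ∞ fun y => curl u y j := fun j => contDiff_euclidean.1 hω j
  exact ⟨h1, h2, fun i j => contDiff_pderiv (h1 j) i, fun i j => contDiff_pderiv (h2 j) i,
    fun i j => contDiff_pderiv (contDiff_pderiv (h2 j) i) i⟩

end FoldLaw

end Summit.NavierStokesRegularity.NavierStokesRegularity.Theorems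

end
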